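import Summits.CriticalPhenomena.PercolationContinuityZ3.Theorems.PercNearOneGluingNoHeavyQuantFarTwoTerminalExitEventwise
import HarnessLib

/-!
# QUANT lane R8, front "FAR beyond trees", layer one — THE GUARDED-BLOCK LEMMA (a graph-structural two-terminal certificate)

builds on p205010 (kernel theorem, internal audit signed; external expert review pending)

Support file (`--supports stmt-CriticalPhenomena-4575`), seat `prim-quant-p1` (gen 25); memo
`run/shared/lean/prim/quant/prim-quant-p1-g25/FOR-LEAD-TWOTERMINAL.md` §3.  Standard axioms; no sorries; no definitions.

A two-terminal block `Z` (hanging at `c₁, c₂`; observer `o ∉ Z`) is GUARDED if every ENTRANCE of `Z` — every `z ∈ Z` joined to `c₁` or to `c₂` by a pair of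
positive weight — is a relay.  If moreover `Z` contains a relay `a` that is not an entrance, then every on-`Z` path from a terminal to `a` first steps onto a
guard, so two relays of the block are joined to that terminal: the support form of the two-terminal exit lemma
(`Block.real_card_le_one_le_of_exit₂_support`) applies and gives
* **`Block.real_card_le_one_le_of_guarded`**: `P(#{x ∈ A : o ↔ x} ≤ 1) ≤ P(o ↮ a)` — in EVERY environment, with NO mean hypothesis;
* `Block.farLayerOne_of_guarded`: the `j = 1` conclusion of `Quant.FarRelayRow` for every such graph.
Examples: an ear `c₁ – v₁ – ⋯ – v_L – c₂` whose end vertices `v₁, v_L` are sure relays and which carries any further relay (inside vertex or hair);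
a pendant-free 2-connected gadget attached at two relay vertices.  This strictly extends the shielded-relay lemma (`…QuantFarShieldedRelay`: there the
guards are the neighbours of `a` itself).  Consequence for a minimal counterexample to FAR at layer one: no 2-separation block is guarded with a spare relay.
[cite: Grimmett1999, §1.3 p. 10] (open paths); [this work].
-/

noncomputable section

namespace Summit.CriticalPhenomena.PercolationContinuityZ3.Theorems

namespace Quant

namespace Block

open Finset MeasureTheory Set
open Literature.Probability.LatticeModels
open Literature.Probability.Percolation
open scoped Classical

variable {n : ℕ}

variable {o c₁ c₂ : Fin n} {Z : Finset (Fin n)}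

/-- **First step of an on-`Z` path from a terminal.**  If `c ∉ Z` is joined on `Z` to `a ≠ c` in a configuration inside the support of `v`, then some
`z ∈ Z` with `v(s(c,z)) ≠ 0` is adjacent to `c` in the on-`Z` graph (in particular joined to `c` on `Z`). [this work] -/
theorem exists_entrance_of_onZ_reachable (v : Sym2 (Fin n) → unitInterval) {ω : BondConfig (Fin n)} (hω : ∀ e ∈ ω, (v e : ℝ) ≠ 0)
    {c a : Fin n} (hc : c ∉ Z) (hca : c ≠ a) (h : (openGraph (onZ Z ω)).Reachable c a) :
    ∃ z ∈ Z, (v s(c, z) : ℝ) ≠ 0 ∧ (openGraph (onZ Z ω)).Reachable c z := by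
  obtain ⟨p⟩ := h
  cases p with
  | nil => exact absurd rfl hca
  | cons hadj q =>
    rename_i x
    rw [openGraph_adj] at hadj
    obtain ⟨he, hne⟩ := hadj
    -- `s(c, x)` is an open pair meeting `Z`; since `c ∉ Z`, `x ∈ Z`
    obtain ⟨hxω, z, hzZ, hzx⟩ := he
    have hxZ : x ∈ Z := by
      rcases Sym2.mem_iff.1 hzx with rfl | rfl
      · exact absurd hzZ hc
      · exact hzZ
    refine ⟨x, hxZ, hω _ hxω, ?_⟩
    have hadj' : (openGraph (onZ Z ω)).Adj c x := by
      rw [openGraph_adj]; exact ⟨⟨hxω, z, hzZ, hzx⟩, hne⟩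
    exact hadj'.reachable

/-- **The guarded-block lemma.**  Block `Z` at `c₁, c₂` (`o, c₁, c₂ ∉ Z`, weights vanishing between `Z` and `(Z ∪ {c₁,c₂})ᶜ`), relay set `A`; every entrance is a
relay (`z ∈ Z`, `v(s(c_i, z)) ≠ 0 ⟹ z ∈ A`), and `a ∈ A ∩ Z` is not an entrance (`v(s(c₁,a)) = v(s(c₂,a)) = 0`).  Then `P(#{x ∈ A : o ↔ x} ≤ 1) ≤ P(o ↮ a)`.
[this work] -/
theorem real_card_le_one_le_of_guarded (v : Sym2 (Fin n) → unitInterval) (ho : o ∉ Z) (hc₁ : c₁ ∉ Z) (hc₂ : c₂ ∉ Z)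
    (hv : ∀ x y : Fin n, x ≠ y → x ∈ Z → y ∉ Z → y ≠ c₁ → y ≠ c₂ → (v s(x, y) : ℝ) = 0)
    (A : Finset (Fin n)) (hg₁ : ∀ z ∈ Z, (v s(c₁, z) : ℝ) ≠ 0 → z ∈ A) (hg₂ : ∀ z ∈ Z, (v s(c₂, z) : ℝ) ≠ 0 → z ∈ A)
    {a : Fin n} (haA : a ∈ A) (haZ : a ∈ Z) (ha₁ : (v s(c₁, a) : ℝ) = 0) (ha₂ : (v s(c₂, a) : ℝ) = 0) :
    (prodBernoulli v).real {ω : BondConfig (Fin n) | (A.filter fun x => ω ∈ openConn o x).card ≤ 1} ≤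
      (prodBernoulli v).real (openConn o a : Set (BondConfig (Fin n)))ᶜ := by
  have hc₁a : c₁ ≠ a := fun h => hc₁ (h ▸ haZ)
  have hc₂a : c₂ ≠ a := fun h => hc₂ (h ▸ haZ)
  -- two distinct members give a count `≥ 2`
  have two : ∀ (T : Finset (Fin n)) (z : Fin n), z ∈ T → a ∈ T → z ≠ a → 2 ≤ T.card := by
    intro T z hz ha hza
    have hsub : ({z, a} : Finset (Fin n)) ⊆ T := by
      intro x hx
      rcases mem_insert.1 hx with rfl | hx
      · exact hz
      · rw [mem_singleton.1 hx]; exact ha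
    calc 2 = ({z, a} : Finset (Fin n)).card := by rw [card_pair hza]
      _ ≤ _ := card_le_card hsub
  have haAZ : a ∈ A ∩ Z := Finset.mem_inter.2 ⟨haA, haZ⟩
  refine real_card_le_one_le_of_exit₂_support v ho hv A haA haZ ?_ ?_ ?_
  · intro ω hω h
    obtain ⟨z, hzZ, hvz, hz⟩ := exists_entrance_of_onZ_reachable v hω hc₁ hc₁a h
    have hza : z ≠ a := fun hza => hvz (hza ▸ ha₁)
    exact two _ z (mem_filter.2 ⟨Finset.mem_inter.2 ⟨hg₁ z hzZ hvz, hzZ⟩, hz⟩) (mem_filter.2 ⟨haAZ, h⟩) hza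
  · intro ω hω h
    obtain ⟨z, hzZ, hvz, hz⟩ := exists_entrance_of_onZ_reachable v hω hc₂ hc₂a h
    have hza : z ≠ a := fun hza => hvz (hza ▸ ha₂)
    exact two _ z (mem_filter.2 ⟨Finset.mem_inter.2 ⟨hg₂ z hzZ hvz, hzZ⟩, hz⟩) (mem_filter.2 ⟨haAZ, h⟩) hza
  · intro ω hω h
    rcases h with h | h
    · obtain ⟨z, hzZ, hvz, hz⟩ := exists_entrance_of_onZ_reachable v hω hc₁ hc₁a h
      have hza : z ≠ a := fun hza => hvz (hza ▸ ha₁)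
      exact two _ z (mem_filter.2 ⟨Finset.mem_inter.2 ⟨hg₁ z hzZ hvz, hzZ⟩, Or.inl hz⟩) (mem_filter.2 ⟨haAZ, Or.inl h⟩) hza
    · obtain ⟨z, hzZ, hvz, hz⟩ := exists_entrance_of_onZ_reachable v hω hc₂ hc₂a h
      have hza : z ≠ a := fun hza => hvz (hza ▸ ha₂)
      exact two _ z (mem_filter.2 ⟨Finset.mem_inter.2 ⟨hg₂ z hzZ hvz, hzZ⟩, Or.inr hz⟩) (mem_filter.2 ⟨haAZ, Or.inr h⟩) hza

/-- **FAR at layer one on every graph with a guarded two-terminal block carrying a spare relay** (route vocabulary): under the hypotheses of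
`real_card_le_one_le_of_guarded`, `P(o ↮ x) ≤ t` on `A` gives `P(#{x ∈ A : o ↔ x} ≤ 1) ≤ t`. [this work] -/
theorem farLayerOne_of_guarded (v : Sym2 (Fin n) → unitInterval) (ho : o ∉ Z) (hc₁ : c₁ ∉ Z) (hc₂ : c₂ ∉ Z)
    (hv : ∀ x y : Fin n, x ≠ y → x ∈ Z → y ∉ Z → y ≠ c₁ → y ≠ c₂ → (v s(x, y) : ℝ) = 0)
    (A : Finset (Fin n)) (hg₁ : ∀ z ∈ Z, (v s(c₁, z) : ℝ) ≠ 0 → z ∈ A) (hg₂ : ∀ z ∈ Z, (v s(c₂, z) : ℝ) ≠ 0 → z ∈ A)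
    {a : Fin n} (haA : a ∈ A) (haZ : a ∈ Z) (ha₁ : (v s(c₁, a) : ℝ) = 0) (ha₂ : (v s(c₂, a) : ℝ) = 0)
    (t : ℝ) (hcut : ∀ x ∈ A, (prodBernoulli v).real (openConn o x : Set (BondConfig (Fin n)))ᶜ ≤ t) :
    (prodBernoulli v).real {ω : BondConfig (Fin n) | (A.filter fun x => ω ∈ openConn o x).card ≤ 1} ≤ t :=
  (real_card_le_one_le_of_guarded v ho hc₁ hc₂ hv A hg₁ hg₂ haA haZ ha₁ ha₂).trans (hcut a haA)

end Block

end Quant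

end Summit.CriticalPhenomena.PercolationContinuityZ3.Theorems
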